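import Literature.AlgebraicGeometry.GroupSchemes.BTGroupConnectedDimOneCoordinates   -- ★ p845010 (S, A-p17): natural coordinates of a connected BT group of dimension one
import Literature.AlgebraicGeometry.GroupSchemes.BTGroupOModuleLawOfCoordinates      -- ★ (P4b, this hand): tangent character + formal `𝒪`-module law in the coordinates
import Literature.AlgebraicGeometry.GroupSchemes.BTGroupDictionaryOfCoordinates      -- ★ p845025 (P5, A-p17): the torsion-points dictionary `e`
import HarnessLib

/-!
# Crux `HLiu418` — P6 sub-line **F0-P6d ConnectedBTDictionary**, stub (HL-D) `ConnectedDimOneIsOModuleLaw` PAID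

Cell `hodgecm-mathlib`, P6 «MOD programme», line `Cruxes/HLiu418/Lines/F0_P6d_ConnectedBTDictionary.lean` (desk F0P6d-plan (g0),
ED. 3), letter (HL-D) «a connected `p`-divisible group of dimension one over a field of characteristic `p` with a ring action IS
the `p^∞`-torsion of a formal `𝒪`-module law» [Tate1967, §2.2 Prop. 1] [Messing1972, Ch. II (3.3.18)].  This file proves THE
TEXT OF `ConnectedDimOneIsOModuleLaw p H` VERBATIM (same binders, universes `u`, `v`) as `connectedDimOneIsOModuleLaw p H` —
WITHOUT the line's `[Fact p.Prime]` (here `2 ≤ p` is derived: the layers of a connected BT group are nonzero and `(p : k) = 0`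
in a field) — so that the desk folds `stub_HLD p H := F0P6dStubHLD.connectedDimOneIsOModuleLaw p H` BY NAME.

ASSEMBLY (σ1 «monogenic tower», all inputs ★): (S) ★ `BTGroup.exists_coordinates_of_isConnectedDimOne` (natural coordinates
`c n R : B.G n (R) ≃ {x ∣ x^{p^{nH}} = 0}` from `Γ(B.G n) ≃ k[X]/(X^{p^{nH}})` compatibly) → (P4b) ★
`BTGroup.exists_formalOModuleLaw_of_coordinates` (tangent character `χ`, formal `𝒪`-module law `M` with `c (f·g) = M(c f, c g)`,
`c (f ≫ β a) = [a]_M (c f)`; built from ★ (P1) series per layer, ★ (P2)(P3) bud axioms below the box, the tower along `incl`,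
★ (P4a) `exists_formalOModuleLaw_of_tower` = tangent character + ★ `exists_formalOModuleLaw_of_buds`) → (P5) ★
`BTGroup.exists_isPTorsionOfOLawVia_of_coordinates` (the identification `{x ∣ x^{p^{nH}} = 0} = M[pⁿ](R)` and the four
dictionary clauses).  HC_CM is proved only modulo the printed citations until rung 0 closes; nothing here is about HC — it
discharges one registered stub of the P6d line.
-/

-- The cell's namespace `Summit.HodgeConjecture.HodgeConjecture.…` repeats `HodgeConjecture` (summit = sub-problem), which
-- `linter.dupNamespace` flags; the lakefile turns the linter off tree-wide (weak option), restated here so stand-alone elaboration is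
-- warning-free.
set_option linter.dupNamespace false

open AlgebraicGeometry CategoryTheory
open Literature.AlgebraicGeometry.GroupSchemes
open Literature.RingTheory.FormalGroups (FormalOModuleLaw)

namespace Summit.HodgeConjecture.HodgeConjecture.Cruxes.HLiu418.F0P6dStubHLD

universe u v

/-- **Stub (HL-D) «connected BT groups of dimension one with a ring action are `p^∞`-torsion of formal `𝒪`-module laws» —
the text of `F0P6dConnectedBTDictionary.ConnectedDimOneIsOModuleLaw p H` verbatim.**  For a field `k` with `(p : k) = 0`,
`0 < H`, a BT group `B` over `k` of height `H` with `Γ(B.G n) ≃ k[X]/(X^{p^{nH}})` compatibly (`IsConnectedDimOne B`), and a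
ring action `β : 𝒪 → End B`: there are the tangent character `χ : 𝒪 →+* k`, a formal `𝒪`-module law `M` over `k` (for the
algebra structure `χ`) and bijections `e n R : B.G n (R) ≃ M[pⁿ](R)` on all `k`-algebras making `B = M[p^∞]` with `β = [·]_M`
(`IsPTorsionOfOLawVia`).  Proof: ★ (S) coordinates ∘ ★ (P4b) law ∘ ★ (P5) dictionary; `2 ≤ p` from
★ `BTGroup.pow_ne_zero_of_isConnectedDimOne` and `(p : k) = 0`.
[cite: Tate1967, §2.2 Prop. 1] [cite: Messing1972, Ch. II (3.3.18)] -/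
theorem connectedDimOneIsOModuleLaw (p H : ℕ) :
    ∀ (k : Type u) [Field k], (p : k) = 0 → 0 < H → ∀ (B : BTGroup (Spec (.of k)) p H), IsConnectedDimOne B →
      ∀ (𝒪 : Type v) [CommRing 𝒪] (β : 𝒪 → BTGroup.Hom B B), IsRingActionBT B β →
        ∃ χ : 𝒪 →+* k, letI := χ.toAlgebra
        ∃ M : FormalOModuleLaw 𝒪 k, haveI := M.isComm'
        ∃ e : ∀ (n : ℕ) (R : Type u) [CommRing R] [Algebra k R], (specOver R ⟶ B.G n) ≃ TorsPts M.toFormalGroup p n R,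
          IsPTorsionOfOLawVia 𝒪 M.toFormalGroup M.act p B β e := by
  intro k _ hpk hH B hB 𝒪 _ β hβ
  -- `2 ≤ p`: `p ≠ 0` since the layers of a connected BT group are nonzero (`p ^ (1·H) ≠ 0`); `p ≠ 1` since `(1 : k) ≠ 0`
  have hp : 2 ≤ p := by
    have h0 : p ≠ 0 := fun h => B.pow_ne_zero_of_isConnectedDimOne hB 1 (by rw [h, one_mul, zero_pow hH.ne'])
    have h1 : p ≠ 1 := fun h => one_ne_zero (α := k) (by rw [h, Nat.cast_one] at hpk; exact hpk)
    omega
  obtain ⟨c, hnat, hincl⟩ := B.exists_coordinates_of_isConnectedDimOne hB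
  obtain ⟨χ, M, hlaw, hact⟩ := B.exists_formalOModuleLaw_of_coordinates c hp hH hnat hincl β hβ
  letI := χ.toAlgebra
  haveI := M.isComm'
  obtain ⟨e, he, -⟩ := B.exists_isPTorsionOfOLawVia_of_coordinates c M.toFormalGroup hp hH hlaw hincl hnat M.act β hact
  exact ⟨χ, M, e, he⟩

end Summit.HodgeConjecture.HodgeConjecture.Cruxes.HLiu418.F0P6dStubHLD
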